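import Summits.KontsevichZagierPeriods.KontsevichZagierPeriods.Theorems.SoloBlindFifthRoot
import HarnessLib

/-!
# Cauchy's theorem inside the rules, I: the Fermat-quintic form on a half-plane

The relation `B(a,a) = 2cos(πa) · B(a,1-2a)` (`0 < a < 1/2`) between Beta values is, classically,
Cauchy's theorem for the multivalued form `ω = (z(1-z))^{a-1} dz` (periods of the Fermat curve):
the integral of the principal branch `g(z) = (z(1-z))^{a-1}` over the boundary of the half-plane
`H = {Re z < 1/2, Im z > 0}` vanishes, the two boundary pieces being `∫_{-∞}^{0} g = -cos(πa)
B(a,1-2a)` and `∫_0^{1/2} g = B(a,a)/2`, while `Re(g dz) = -Im g dy` vanishes on `Re z = 1/2`.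

Kontsevich–Zagier's rules know no complex analysis.  This file and its sequels
(`SoloBlindCauchy*`) run the argument INSIDE the rules: Stokes for the real `1`-form `Re(g dz) =
P dx - Q dy` (`P = Re g`, `Q = Im g`) on `H`, i.e. `∬_H h = ∮ P dx - Q dy` with
`h = ∂P/∂y = -∂Q/∂x = -Im g'` (Cauchy–Riemann), realised as TWO Newton–Leibniz moves (rule 3)
applied to the same absolutely convergent `2`-dimensional representation `[H, h]` — once in `y`
(boundary values `P(x,0)`), once in `x` (boundary values `Q(1/2,y) = 0`) — after algebraic charts
compactifying the fibres (rule 2).  Here: the form, its derivative, the Cauchy–Riemann partials,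
the boundary values on the three edges and the continuity / decay facts the moves need.

References: A.-L. Cauchy (1825); Kontsevich–Zagier, *Periods* (2001), §1.2 (rules 1–3: "replace
the Newton–Leibniz formula by Stokes's formula"); Whittaker–Watson, *Modern Analysis*, §12.41.
-/

noncomputable section

namespace Summit.KontsevichZagierPeriods.KontsevichZagierPeriods.Theorems

open Set Complex Filter
open scoped Topology

namespace SoloBlind

/-! ## The form and its derivative -/

/-- `w(z) = z(1 - z)`. -/
def wOf (z : ℂ) : ℂ := z * (1 - z)

/-- `g_e(z) = (z(1-z))^e` (principal branch). -/
def gPow (e : ℝ) (z : ℂ) : ℂ := wOf z ^ (e : ℂ)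

/-- `g_e'(z) = e (z(1-z))^{e-1} (1 - 2z)`. -/
def gDer (e : ℝ) (z : ℂ) : ℂ := (e : ℂ) * wOf z ^ ((e : ℂ) - 1) * (1 - 2 * z)

/-- `Re w(x+iy) = x - x² + y²`. -/
theorem wOf_re (x y : ℝ) : (wOf (x + y * I)).re = x - x ^ 2 + y ^ 2 := by
  simp only [wOf, mul_re, mul_im, sub_re, sub_im, add_re, add_im, ofReal_re, ofReal_im, I_re, I_im,
    one_re, one_im]
  ring

/-- `Im w(x+iy) = y(1 - 2x)`. -/
theorem wOf_im (x y : ℝ) : (wOf (x + y * I)).im = y * (1 - 2 * x) := by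
  simp only [wOf, mul_re, mul_im, sub_re, sub_im, add_re, add_im, ofReal_re, ofReal_im, I_re, I_im,
    one_re, one_im]
  ring

/-- `w` as a real pair: `w(x+iy) = (x - x² + y²) + i y(1-2x)`. -/
theorem wOf_eq (x y : ℝ) :
    wOf (x + y * I) = ((x - x ^ 2 + y ^ 2 : ℝ) : ℂ) + ((y * (1 - 2 * x) : ℝ) : ℂ) * I :=
  Complex.ext (by simp only [wOf_re, add_re, mul_re, ofReal_re, ofReal_im, I_re, I_im]; ring)
    (by simp only [wOf_im, add_im, mul_im, ofReal_re, ofReal_im, I_re, I_im]; ring)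

/-- On the closed half-plane `Re z ≤ 1/2, Im z ≥ 0`: `Im w ≥ 0`. -/
theorem wOf_im_nonneg {x y : ℝ} (hx : x ≤ 1 / 2) (hy : 0 ≤ y) : 0 ≤ (wOf (x + y * I)).im := by
  rw [wOf_im]; exact mul_nonneg hy (by linarith)

/-- On the open half-plane `Re z < 1/2, Im z > 0`: `w ∈ slitPlane` (`Im w > 0`). -/
theorem wOf_mem_slitPlane {x y : ℝ} (hx : x < 1 / 2) (hy : 0 < y) :
    wOf (x + y * I) ∈ slitPlane :=
  Or.inr (by rw [wOf_im]; exact (mul_pos hy (by linarith)).ne')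

/-- On `Re z ≤ 1/2`, away from `z = 0`: `w ≠ 0`. -/
theorem wOf_ne_zero {x y : ℝ} (hx : x ≤ 1 / 2) (h0 : 0 < y ∨ x ≠ 0) (hy : 0 ≤ y) :
    wOf (x + y * I) ≠ 0 := by
  have hre := wOf_re x y
  have him := wOf_im x y
  intro h
  rw [h] at hre him
  simp only [zero_re, zero_im] at hre him
  rcases h0 with h0 | h0
  · have h1 : 1 - 2 * x = 0 := by
      rcases mul_eq_zero.mp him.symm with h2 | h2
      · exact absurd h2 h0.ne'
      · exact h2
    nlinarith [sq_nonneg y]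
  · rcases mul_eq_zero.mp him.symm with h2 | h2
    · subst h2
      have : x * (1 - x) = 0 := by nlinarith
      rcases mul_eq_zero.mp this with h3 | h3
      · exact h0 h3
      · linarith
    · nlinarith [sq_nonneg y]

/-- On the vertical edge `Re z = 1/2`: `w = 1/4 + y²` is a positive real. -/
theorem wOf_half (y : ℝ) : wOf ((1 / 2 : ℝ) + y * I) = ((1 / 4 + y ^ 2 : ℝ) : ℂ) := by
  rw [wOf_eq]; push_cast; ring

/-- `w' = 1 - 2z`. -/
theorem hasDerivAt_wOf (z : ℂ) : HasDerivAt wOf (1 - 2 * z) z :=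
  ((hasDerivAt_id z).mul ((hasDerivAt_id z).const_sub 1)).congr_deriv (by simp only [id]; ring)

/-- `g_e' ` is the complex derivative of `g_e` wherever `w ∈ slitPlane`. -/
theorem hasDerivAt_gPow {e : ℝ} {z : ℂ} (hz : wOf z ∈ slitPlane) :
    HasDerivAt (gPow e) (gDer e z) z :=
  (hasDerivAt_wOf z).cpow_const (c := (e : ℂ)) hz

/-- `g_e' = e · g_e · (1-2z)/w` away from `w = 0`. -/
theorem gDer_eq {e : ℝ} {z : ℂ} (hw : wOf z ≠ 0) :
    gDer e z = (e : ℂ) * (gPow e z / wOf z) * (1 - 2 * z) := by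
  rw [gDer, gPow, cpow_sub _ _ hw, cpow_one]

/-- At level `5`: `g_{p/5-1} = (w^{1/5})^p / w` away from `w = 0`. -/
theorem gPow_eq_root5 (p : ℕ) {z : ℂ} (hw : wOf z ≠ 0) :
    gPow ((p : ℝ) / 5 - 1) z = root5 (wOf z) ^ p / wOf z := by
  have hc : (((p : ℝ) / 5 - 1 : ℝ) : ℂ) = (p : ℂ) * (5 : ℂ)⁻¹ - 1 := by push_cast; ring
  rw [gPow, hc, cpow_sub _ _ hw, cpow_one, cpow_nat_mul, root5]

/-! ## Cauchy–Riemann: the partial derivatives of `P = Re g`, `Q = Im g` -/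

/-- `∂/∂y Re g(x+iy) = -Im g'(x+iy)`. -/
theorem hasDerivAt_re_gPow {e x y : ℝ} (hz : wOf (x + y * I) ∈ slitPlane) :
    HasDerivAt (fun s : ℝ => (gPow e (x + s * I)).re) (-(gDer e (x + y * I)).im) y := by
  have hin : HasDerivAt (fun s : ℂ => (x : ℂ) + s * I) I (y : ℂ) := by
    simpa using ((hasDerivAt_id (y : ℂ)).mul_const I).const_add (x : ℂ)
  have hcomp : HasDerivAt (gPow e ∘ fun s : ℂ => (x : ℂ) + s * I) (gDer e (x + y * I) * I)
      (y : ℂ) := HasDerivAt.comp (y : ℂ) (hasDerivAt_gPow hz) hin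
  have h := hcomp.real_of_complex
  rw [show -(gDer e (x + y * I)).im = (gDer e (x + y * I) * I).re by simp]
  exact h

/-- `∂/∂x Im g(x+iy) = Im g'(x+iy)`. -/
theorem hasDerivAt_im_gPow {e x y : ℝ} (hz : wOf (x + y * I) ∈ slitPlane) :
    HasDerivAt (fun s : ℝ => (gPow e (s + y * I)).im) (gDer e (x + y * I)).im x := by
  have hin : HasDerivAt (fun s : ℂ => s + y * I) 1 (x : ℂ) := by
    simpa using (hasDerivAt_id (x : ℂ)).add_const ((y : ℂ) * I)
  have hcomp : HasDerivAt (fun s : ℂ => -I * (gPow e ∘ fun s : ℂ => s + y * I) s)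
      (-I * (gDer e (x + y * I) * 1)) (x : ℂ) :=
    (HasDerivAt.comp (x : ℂ) (hasDerivAt_gPow hz) hin).const_mul (-I)
  have h := hcomp.real_of_complex
  have hfun : (fun s : ℝ => (gPow e (s + y * I)).im) =
      fun s : ℝ => (-I * (gPow e ∘ fun s : ℂ => s + y * I) s).re := by
    funext s; simp
  rw [hfun, show (gDer e (x + y * I)).im = (-I * (gDer e (x + y * I) * 1)).re by simp]
  exact h

/-! ## Boundary values on the three edges -/

/-- On `(0,1) ⊆ ℝ`: `g_e(x) = (x(1-x))^e` is real. -/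
theorem gPow_ofReal_pos {e x : ℝ} (hx0 : 0 < x) (hx1 : x < 1) :
    gPow e x = (((x * (1 - x)) ^ e : ℝ) : ℂ) := by
  rw [gPow, wOf, ofReal_cpow (mul_pos hx0 (by linarith)).le]
  push_cast
  ring_nf

/-- On `(-∞,0) ⊆ ℝ` (approached from the upper half-plane, principal branch):
`g_e(x) = (|x|(1-x))^e · e^{iπe}`. -/
theorem gPow_ofReal_neg {e x : ℝ} (hx : x < 0) :
    gPow e x = (((-(x * (1 - x))) ^ e : ℝ) : ℂ) * exp (((Real.pi * e : ℝ) : ℂ) * I) := by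
  have hw : x * (1 - x) ≤ 0 := (mul_neg_of_neg_of_pos hx (by linarith)).le
  rw [gPow, wOf, show (x : ℂ) * (1 - x) = ((x * (1 - x) : ℝ) : ℂ) by push_cast; ring,
    ofReal_cpow_of_nonpos hw, ← ofReal_neg, ← ofReal_cpow (by linarith)]
  congr 1
  push_cast
  ring_nf

/-- Real part on `(-∞,0)`: `Re g_e(x) = cos(πe) (|x|(1-x))^e`. -/
theorem re_gPow_ofReal_neg {e x : ℝ} (hx : x < 0) :
    (gPow e x).re = Real.cos (Real.pi * e) * (-(x * (1 - x))) ^ e := by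
  rw [gPow_ofReal_neg hx, re_ofReal_mul, exp_ofReal_mul_I_re, mul_comm]

/-- Real part on `(0,1)`: `Re g_e(x) = (x(1-x))^e`. -/
theorem re_gPow_ofReal_pos {e x : ℝ} (hx0 : 0 < x) (hx1 : x < 1) :
    (gPow e x).re = (x * (1 - x)) ^ e := by
  rw [gPow_ofReal_pos hx0 hx1, ofReal_re]

/-- On the vertical edge `Re z = 1/2`: `Im g_e = 0`. -/
theorem im_gPow_half (e y : ℝ) : (gPow e ((1 / 2 : ℝ) + y * I)).im = 0 := by
  rw [gPow, wOf_half, ← ofReal_cpow (by positivity), ofReal_im]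

/-! ## Continuity -/

/-- `w` is continuous. -/
theorem continuous_wOf : Continuous wOf :=
  continuous_id.mul (continuous_const.sub continuous_id)

/-- `g_e` is continuous at every `z` with `w(z) ∈ slitPlane`. -/
theorem continuousAt_gPow {e : ℝ} {z : ℂ} (hz : wOf z ∈ slitPlane) :
    ContinuousAt (gPow e) z :=
  ContinuousAt.comp (g := fun w : ℂ => w ^ (e : ℂ)) (continuousAt_cpow_const hz)
    continuous_wOf.continuousAt

/-- The principal power `w ↦ w^e` is continuous from the closed upper half-plane at a negative
real `w₀`. -/
theorem continuousWithinAt_cpow_upper {e : ℝ} {w₀ : ℂ} (hre : w₀.re < 0) (him : w₀.im = 0) :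
    ContinuousWithinAt (fun w : ℂ => w ^ (e : ℂ)) {w | 0 ≤ w.im} w₀ := by
  have hw0 : w₀ ≠ 0 := fun h => by simp [h] at hre
  have hlog := continuousWithinAt_log_of_re_neg_of_im_zero hre him
  have h1 : ContinuousWithinAt (fun w => exp (log w * e)) {w | 0 ≤ w.im} w₀ :=
    (hlog.mul continuousWithinAt_const).cexp
  have hne : ∀ᶠ w in 𝓝[{w : ℂ | 0 ≤ w.im}] w₀, w ≠ 0 :=
    mem_nhdsWithin_of_mem_nhds (isOpen_ne.mem_nhds hw0)
  refine h1.congr_of_eventuallyEq (hne.mono fun w hw => ?_) (cpow_def_of_ne_zero hw0 _)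
  exact cpow_def_of_ne_zero hw _

/-- Continuity of `y ↦ g_e(x+iy)` from the right at `y = 0`, for `x < 0`. -/
theorem continuousWithinAt_gPow_neg {e x : ℝ} (hx : x < 0) :
    ContinuousWithinAt (fun y : ℝ => gPow e (x + y * I)) (Ici 0) 0 := by
  have hre : (wOf (x + (0 : ℝ) * I)).re < 0 := by rw [wOf_re]; nlinarith
  have him : (wOf (x + (0 : ℝ) * I)).im = 0 := by rw [wOf_im]; ring
  have h1 := continuousWithinAt_cpow_upper (e := e) hre him
  have h2 : ContinuousWithinAt (fun y : ℝ => wOf (x + y * I)) (Ici 0) 0 :=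
    (continuous_wOf.comp (by fun_prop : Continuous fun y : ℝ => (x : ℂ) + y * I)).continuousWithinAt
  exact ContinuousWithinAt.comp (f := fun y : ℝ => wOf (x + y * I)) h1 h2
    fun y hy => wOf_im_nonneg (by linarith) hy

/-- Continuity of `y ↦ g_e(x+iy)` at every `y ≥ 0` (from the right at `y = 0`), for
`0 < x < 1/2`, and at every `y > 0` for `x < 1/2`. -/
theorem continuousAt_gPow_of_pos {e x y : ℝ} (hx : x < 1 / 2) (h : 0 < y ∨ 0 < x) :
    ContinuousAt (fun s : ℝ => gPow e (x + s * I)) y := by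
  have hz : wOf (x + y * I) ∈ slitPlane := by
    rcases h with hy | hx0
    · exact wOf_mem_slitPlane hx hy
    · refine Or.inl ?_
      rw [wOf_re]
      nlinarith [sq_nonneg y]
  exact ContinuousAt.comp (f := fun s : ℝ => (x : ℂ) + s * I) (continuousAt_gPow hz)
    (by fun_prop)

/-- Continuity of `x ↦ g_e(x+iy)` at every `x ≤ 1/2`, for `y > 0`. -/
theorem continuousAt_gPow_dx {e x y : ℝ} (hx : x ≤ 1 / 2) (hy : 0 < y) :
    ContinuousAt (fun s : ℝ => gPow e (s + y * I)) x := by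
  have hz : wOf (x + y * I) ∈ slitPlane := by
    rcases hx.lt_or_eq with hx | rfl
    · exact wOf_mem_slitPlane hx hy
    · refine Or.inl ?_
      rw [wOf_re]
      nlinarith [sq_nonneg y]
  exact ContinuousAt.comp (f := fun s : ℝ => (s : ℂ) + y * I) (continuousAt_gPow hz)
    (by fun_prop)

/-! ## Decay -/

/-- `|g_e(x+iy)| ≤ y^{2e}` for `e ≤ 0`, `y > 0` (`|w| = |z||1-z| ≥ y²`). -/
theorem norm_gPow_le_of_im {e x y : ℝ} (he : e ≤ 0) (hy : 0 < y) :
    ‖gPow e (x + y * I)‖ ≤ (y ^ 2) ^ e := by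
  rw [gPow, norm_cpow_real]
  refine Real.rpow_le_rpow_of_nonpos (by positivity) ?_ he
  rw [wOf, norm_mul]
  have h1 : y ≤ ‖(x : ℂ) + y * I‖ := by
    have := abs_im_le_norm ((x : ℂ) + y * I)
    simp at this
    simpa [abs_of_pos hy] using this
  have h2 : y ≤ ‖1 - ((x : ℂ) + y * I)‖ := by
    have := abs_im_le_norm (1 - ((x : ℂ) + y * I))
    simp at this
    simpa [abs_of_pos hy] using this
  nlinarith [norm_nonneg ((x : ℂ) + y * I), norm_nonneg (1 - ((x : ℂ) + y * I))]

/-- `|g_e(x+iy)| ≤ x^{2e}` for `e ≤ 0`, `x < 0` (`|w| = |z||1-z| ≥ x²`). -/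
theorem norm_gPow_le_of_re {e x y : ℝ} (he : e ≤ 0) (hx : x < 0) :
    ‖gPow e (x + y * I)‖ ≤ (x ^ 2) ^ e := by
  rw [gPow, norm_cpow_real]
  refine Real.rpow_le_rpow_of_nonpos (by nlinarith) ?_ he
  rw [wOf, norm_mul]
  have h1 : -x ≤ ‖(x : ℂ) + y * I‖ := by
    have := abs_re_le_norm ((x : ℂ) + y * I)
    simp at this
    simpa [abs_of_neg hx] using this
  have h2 : -x ≤ ‖1 - ((x : ℂ) + y * I)‖ := by
    have := abs_re_le_norm (1 - ((x : ℂ) + y * I))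
    simp at this
    rw [abs_of_pos (by linarith)] at this
    linarith
  nlinarith [norm_nonneg ((x : ℂ) + y * I), norm_nonneg (1 - ((x : ℂ) + y * I))]

end SoloBlind

end Summit.KontsevichZagierPeriods.KontsevichZagierPeriods.Theorems
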